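import Mathlib
import Summits.Ventures.DiscreteObjects.Mahler.SmallMeasureCensus

/-!
# Schinzel's theorem: totally positive algebraic integers have `M ≥ φ^{deg}` (venture `DiscreteObjects`, target L)

Cell `pub-namedobj`, seat `pub-namedobj-mahler` (gen 8). Framing: lottery ticket; floor = certified
bounds/negative ranges.

[McKee–Smyth, *Around the Unit Circle*, Exercise 14.11; Schinzel 1973; short proof of Höhn–Skoruppa 1993.]
With `φ = (1+√5)/2`:

* `hoehn_skoruppa_ineq` — for `0 < y < 1`: `y^a (1-y)^b ≤ φ⁻¹`, `a = (1 - 1/√5)/2`, `b = 1/√5`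
  (weighted AM–GM; equality at `y = φ⁻²`); hence the auxiliary inequality (14.16) in multiplicative form
  `φ · x^a · |x - 1|^b ≤ max(1, x)` for `x > 0`, `x ≠ 1` (`goldenRatio_mul_rpow_le_max`);
* `goldenRatio_pow_le_mahlerMeasure_of_totally_positive` — **Schinzel**: if `P ∈ ℤ[X]` has `P(0) ≠ 0`,
  `P(1) ≠ 0` and all its complex roots real and positive, then `φ^{deg P} ≤ M(P)`.

(The totally real form `M ≥ φ^{deg/2}` for roots `≠ 0, ±1`, (14.17), follows by applying this to the
polynomial with roots `α_i²`; not done here.)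
-/

namespace Summit.Ventures.DiscreteObjects.Mahler

open Polynomial Real

/-- **Höhn–Skoruppa inequality.** For `0 < y < 1`:
`y^{(1 - 1/√5)/2} · (1 - y)^{1/√5} ≤ φ⁻¹` (weighted AM–GM with weights `a, b, a`, `2a + b = 1`,
at the points `y/φ⁻²`, `(1-y)/φ⁻¹`, `1`). -/
theorem hoehn_skoruppa_ineq {y : ℝ} (hy0 : 0 < y) (hy1 : y < 1) :
    y ^ ((1 - 1 / √5) / 2) * (1 - y) ^ (1 / √5) ≤ goldenRatio⁻¹ := by
  have hs2 : (√5 : ℝ) ^ 2 = 5 := Real.sq_sqrt (by norm_num)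
  have hs0 : (0 : ℝ) < √5 := Real.sqrt_pos.mpr (by norm_num)
  have hs1 : (1 : ℝ) < √5 := by nlinarith
  set s : ℝ := √5 with hs
  set a : ℝ := (1 - 1 / s) / 2 with ha
  set b : ℝ := 1 / s with hb
  have ha0 : 0 < a := by
    rw [ha]; have : 1 / s < 1 := (div_lt_one hs0).mpr hs1; linarith
  have hb0 : 0 < b := by rw [hb]; positivity
  have hab : a + b + a = 1 := by rw [ha, hb]; ring
  -- `t = φ⁻¹ = 2/(1+√5)`, `t² = 1 - t`
  set t : ℝ := goldenRatio⁻¹ with ht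
  have hφ : goldenRatio = (1 + s) / 2 := rfl
  have hφ0 : 0 < goldenRatio := Real.goldenRatio_pos
  have ht0 : 0 < t := by rw [ht]; positivity
  have htval : t = 2 / (1 + s) := by rw [ht, hφ, inv_div]
  have ht2 : t ^ 2 = 1 - t := by
    rw [htval]
    field_simp
    nlinarith [hs2]
  -- the two identities `a / t² = b / t` (i.e. `a φ = b`) and `b/t + a = 1`
  have hsm : s - 1 ≠ 0 := by linarith
  have hsm' : -1 + s ≠ 0 := by linarith
  have h1s : 1 + s ≠ 0 := by linarith
  have hs0' : s ≠ 0 := hs0.ne'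
  have hI3 : a / t ^ 2 = b / t := by
    rw [ht2, ha, hb, htval]
    have e1 : (1 : ℝ) - 2 / (1 + s) = (s - 1) / (1 + s) := by field_simp; ring
    rw [e1]
    field_simp
  have hI4 : b / t + a = 1 := by
    rw [ha, hb, htval]
    field_simp
    ring
  -- weighted AM–GM
  have hp1 : 0 ≤ y / t ^ 2 := by positivity
  have hp2 : 0 ≤ (1 - y) / t := div_nonneg (by linarith) ht0.le
  have key := Real.geom_mean_le_arith_mean3_weighted ha0.le hb0.le ha0.le hp1 hp2 zero_le_one hab
  have hrhs : a * (y / t ^ 2) + b * ((1 - y) / t) + a * 1 = 1 := by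
    have e : a * (y / t ^ 2) + b * ((1 - y) / t) + a * 1 = (a / t ^ 2 - b / t) * y + (b / t + a) := by
      ring
    rw [e, hI3, hI4]; ring
  rw [hrhs, Real.one_rpow, mul_one, Real.div_rpow hy0.le (by positivity),
    Real.div_rpow (by linarith) ht0.le] at key
  -- `key : y^a / (t^2)^a * ((1-y)^b / t^b) ≤ 1`
  have hden : (t ^ 2) ^ a * t ^ b = t := by
    rw [show (t ^ 2 : ℝ) = t ^ (2 : ℝ) by norm_cast, ← Real.rpow_mul ht0.le, ← Real.rpow_add ht0]
    have : (2 : ℝ) * a + b = 1 := by linarith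
    rw [this, Real.rpow_one]
  have hpos : 0 < (t ^ 2) ^ a * t ^ b := by positivity
  have e2 : y ^ a / (t ^ 2) ^ a * ((1 - y) ^ b / t ^ b) = (y ^ a * (1 - y) ^ b) / ((t ^ 2) ^ a * t ^ b) := by
    field_simp
  rw [e2, div_le_one hpos, hden] at key
  exact key

/-- **The auxiliary inequality (14.16), multiplicative form.** For real `x > 0`, `x ≠ 1`:
`φ · x^a · |x - 1|^b ≤ max(1, x)` with `a = (1 - 1/√5)/2`, `b = 1/√5`. -/
theorem goldenRatio_mul_rpow_le_max {x : ℝ} (hx0 : 0 < x) (hx1 : x ≠ 1) :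
    goldenRatio * (x ^ ((1 - 1 / √5) / 2) * |x - 1| ^ (1 / √5)) ≤ max 1 x := by
  have hφ0 : 0 < goldenRatio := Real.goldenRatio_pos
  set a : ℝ := (1 - 1 / √5) / 2 with ha
  set b : ℝ := 1 / √5 with hb
  rcases lt_or_gt_of_ne hx1 with hlt | hgt
  · -- `0 < x < 1`: `φ x^a (1-x)^b ≤ 1`
    rw [max_eq_left hlt.le, abs_of_neg (by linarith), neg_sub]
    have h := hoehn_skoruppa_ineq hx0 hlt
    calc goldenRatio * (x ^ a * (1 - x) ^ b)
        ≤ goldenRatio * goldenRatio⁻¹ := mul_le_mul_of_nonneg_left h hφ0.le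
      _ = 1 := mul_inv_cancel₀ hφ0.ne'
  · -- `x > 1`: with `y = 1/x`, `x^a (x-1)^b = x · y^a (1-y)^b`
    rw [max_eq_right hgt.le, abs_of_pos (by linarith)]
    set y : ℝ := x⁻¹ with hy
    have hy0 : 0 < y := by rw [hy]; positivity
    have hy1 : y < 1 := by rw [hy]; exact inv_lt_one_of_one_lt₀ hgt
    have h := hoehn_skoruppa_ineq hy0 hy1
    have hxa : 0 < x ^ a := Real.rpow_pos_of_pos hx0 _
    -- identity: x^a (x-1)^b = x * (y^a (1-y)^b), using a + b + a = 1
    have hxy : x ^ a * (x - 1) ^ b = x * (y ^ a * (1 - y) ^ b) := by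
      have e1 : x - 1 = x * (1 - y) := by rw [hy]; field_simp
      have hya : y ^ a = (x ^ a)⁻¹ := by rw [hy, Real.inv_rpow hx0.le]
      have e2 : x ^ a * x ^ b * x ^ a = x := by
        rw [← Real.rpow_add hx0, ← Real.rpow_add hx0]
        have : a + b + a = 1 := by rw [ha, hb]; ring
        rw [this, Real.rpow_one]
      rw [e1, Real.mul_rpow hx0.le (by linarith), hya]
      field_simp
      linear_combination (1 - y) ^ b * e2
    rw [hxy]
    calc goldenRatio * (x * (y ^ a * (1 - y) ^ b))
        = x * (goldenRatio * (y ^ a * (1 - y) ^ b)) := by ring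
      _ ≤ x * (goldenRatio * goldenRatio⁻¹) :=
          mul_le_mul_of_nonneg_left (mul_le_mul_of_nonneg_left h hφ0.le) hx0.le
      _ = x := by rw [mul_inv_cancel₀ hφ0.ne', mul_one]

/-- `rpow` distributes over products of nonnegative reals indexed by a multiset. -/
theorem multiset_prod_map_rpow {ι : Type*} (s : Multiset ι) (f : ι → ℝ) (hf : ∀ i ∈ s, 0 ≤ f i) (r : ℝ) :
    (s.map f).prod ^ r = (s.map fun i => f i ^ r).prod := by
  induction s using Multiset.induction_on with
  | empty => simp
  | cons a s ih =>
    rw [Multiset.map_cons, Multiset.prod_cons, Multiset.map_cons, Multiset.prod_cons,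
      Real.mul_rpow (hf a (Multiset.mem_cons_self a s))
        (Multiset.prod_map_nonneg fun i hi => hf i (Multiset.mem_cons_of_mem hi)),
      ih fun i hi => hf i (Multiset.mem_cons_of_mem hi)]

/-- **Schinzel's theorem (totally positive case)** [McKee–Smyth, Ex. 14.11; Schinzel 1973; Höhn–Skoruppa
1993].  If `P ∈ ℤ[X]` has `P(0) ≠ 0`, `P(1) ≠ 0` and all its complex roots are positive reals, then
`φ^{deg P} ≤ M(P)`, `φ = (1+√5)/2`. -/
theorem goldenRatio_pow_le_mahlerMeasure_of_totally_positive {P : ℤ[X]} (h0 : P.coeff 0 ≠ 0)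
    (h1 : P.eval 1 ≠ 0) (hpos : ∀ α ∈ (P.map (Int.castRingHom ℂ)).roots, α.im = 0 ∧ 0 < α.re) :
    goldenRatio ^ P.natDegree ≤ intMahlerMeasure P := by
  have hP0 : P ≠ 0 := by rintro rfl; exact h0 (coeff_zero 0)
  have hinj : Function.Injective (Int.castRingHom ℂ) := (Int.castRingHom ℂ).injective_int
  have hPC0 : P.map (Int.castRingHom ℂ) ≠ 0 := (Polynomial.map_ne_zero_iff hinj).mpr hP0
  have hcard : Multiset.card (P.map (Int.castRingHom ℂ)).roots = (P.map (Int.castRingHom ℂ)).natDegree :=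
    ((IsAlgClosed.splits (P.map (Int.castRingHom ℂ))).natDegree_eq_card_roots).symm
  have hdeg : (P.map (Int.castRingHom ℂ)).natDegree = P.natDegree := natDegree_map_eq_of_injective hinj P
  set PC := P.map (Int.castRingHom ℂ) with hPC
  set R := PC.roots with hR
  set c : ℂ := PC.leadingCoeff with hc
  have hprod : C c * (R.map fun a => X - C a).prod = PC := C_leadingCoeff_mul_prod_multiset_X_sub_C hcard
  -- evaluations
  have heval : ∀ z : ℂ, PC.eval z = c * (R.map fun a => z - a).prod := by
    intro z
    conv_lhs => rw [← hprod]
    rw [eval_mul, eval_C, eval_multiset_prod, Multiset.map_map]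
    congr 1
    refine congrArg _ (Multiset.map_congr rfl fun a _ => ?_)
    simp
  have hnorm : ∀ z : ℂ, ‖PC.eval z‖ = ‖c‖ * (R.map fun a => ‖z - a‖).prod := by
    intro z
    rw [heval z, norm_mul]
    congr 1
    have hmp := map_multiset_prod (normHom : ℂ →*₀ ℝ) (R.map fun a => z - a)
    rw [Multiset.map_map] at hmp
    simpa [Function.comp_def] using hmp
  have hev0 : ‖PC.eval 0‖ = |(P.coeff 0 : ℝ)| := by
    rw [hPC, eval_map, eval₂_at_zero, eq_intCast, Complex.norm_intCast]
  have hev1 : ‖PC.eval 1‖ = |((P.eval 1 : ℤ) : ℝ)| := by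
    rw [hPC, eval_map, eval₂_at_one, eq_intCast, Complex.norm_intCast]
  have hge0 : (1 : ℝ) ≤ ‖PC.eval 0‖ := by
    rw [hev0]; exact_mod_cast Int.one_le_abs h0
  have hge1 : (1 : ℝ) ≤ ‖PC.eval 1‖ := by
    rw [hev1]; exact_mod_cast Int.one_le_abs h1
  have hcge : (1 : ℝ) ≤ ‖c‖ := by
    rw [hc, hPC, leadingCoeff_map_of_injective hinj, eq_intCast, Complex.norm_intCast]
    exact_mod_cast Int.one_le_abs (leadingCoeff_ne_zero.mpr hP0)
  -- real roots
  have hreal : ∀ α ∈ R, α = ((α.re : ℝ) : ℂ) := by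
    intro α hα
    apply Complex.ext
    · simp
    · simp [(hpos α hα).1]
  set a : ℝ := (1 - 1 / √5) / 2 with ha
  set b : ℝ := 1 / √5 with hb
  have hs0 : (0 : ℝ) < √5 := Real.sqrt_pos.mpr (by norm_num)
  have hs1 : (1 : ℝ) < √5 := by
    have hs2 : (√5 : ℝ) ^ 2 = 5 := Real.sq_sqrt (by norm_num); nlinarith
  have ha0 : 0 ≤ a := by
    rw [ha]; have : 1 / √5 < 1 := (div_lt_one hs0).mpr hs1; linarith
  have hb0 : 0 ≤ b := by rw [hb]; positivity
  have h2ab : a + b + a = 1 := by rw [ha, hb]; ring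
  -- pointwise inequality on the roots
  have hpt : ∀ α ∈ R, goldenRatio * (‖(0 : ℂ) - α‖ ^ a * ‖(1 : ℂ) - α‖ ^ b) ≤ max 1 ‖α‖ := by
    intro α hα
    obtain ⟨him, hre⟩ := hpos α hα
    have hx1 : α.re ≠ 1 := by
      intro h
      apply h1
      have hroot : PC.eval α = 0 := (mem_roots hPC0).mp hα
      have hα1 : α = 1 := by rw [hreal α hα, h]; simp
      rw [hα1, hPC, eval_map, eval₂_at_one, eq_intCast, Int.cast_eq_zero] at hroot
      exact hroot
    have e0 : ‖(0 : ℂ) - α‖ = α.re := by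
      rw [zero_sub, norm_neg, hreal α hα, Complex.norm_real, Real.norm_eq_abs, Complex.ofReal_re,
        abs_of_pos hre]
    have e1 : ‖(1 : ℂ) - α‖ = |α.re - 1| := by
      rw [hreal α hα, Complex.ofReal_re, ← Complex.ofReal_one, ← Complex.ofReal_sub, Complex.norm_real,
        Real.norm_eq_abs, abs_sub_comm]
    have e2 : ‖α‖ = α.re := by
      rw [hreal α hα, Complex.norm_real, Real.norm_eq_abs, Complex.ofReal_re, abs_of_pos hre]
    rw [e0, e1, e2]
    exact goldenRatio_mul_rpow_le_max hre hx1
  -- products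
  have hR0 : ∀ α ∈ R, 0 ≤ ‖(0 : ℂ) - α‖ := fun α _ => norm_nonneg _
  have hR1 : ∀ α ∈ R, 0 ≤ ‖(1 : ℂ) - α‖ := fun α _ => norm_nonneg _
  have hprodle : (R.map fun α => goldenRatio * (‖(0 : ℂ) - α‖ ^ a * ‖(1 : ℂ) - α‖ ^ b)).prod ≤
      (R.map fun α => max 1 ‖α‖).prod :=
    Multiset.prod_map_le_prod_map₀ _ _ (fun α _ => by positivity) hpt
  rw [Multiset.prod_map_mul, Multiset.prod_map_mul, Multiset.map_const', Multiset.prod_replicate, hcard,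
    hdeg, ← multiset_prod_map_rpow R _ hR0 a, ← multiset_prod_map_rpow R _ hR1 b] at hprodle
  -- `M(P) = ‖c‖ ∏ max(1,|α|)`
  have hM : intMahlerMeasure P = ‖c‖ * (R.map fun α => max 1 ‖α‖).prod :=
    mahlerMeasure_eq_leadingCoeff_mul_prod_roots PC
  set A0 := (R.map fun α => ‖(0 : ℂ) - α‖).prod with hA0
  set A1 := (R.map fun α => ‖(1 : ℂ) - α‖).prod with hA1
  have hA0n : 0 ≤ A0 := Multiset.prod_map_nonneg hR0
  have hA1n : 0 ≤ A1 := Multiset.prod_map_nonneg hR1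
  have hcA0 : ‖c‖ * A0 = ‖PC.eval 0‖ := by rw [hnorm 0]
  have hcA1 : ‖c‖ * A1 = ‖PC.eval 1‖ := by rw [hnorm 1]
  have hc0 : 0 ≤ ‖c‖ := norm_nonneg _
  have hlow : 1 ≤ ‖c‖ * (A0 ^ a * A1 ^ b) := by
    have hc1 : ‖c‖ = ‖c‖ ^ a * ‖c‖ ^ b * ‖c‖ ^ a := by
      rw [← Real.rpow_add' hc0 (by linarith), ← Real.rpow_add' hc0 (by linarith), h2ab, Real.rpow_one]
    have e : ‖c‖ * (A0 ^ a * A1 ^ b) = ‖c‖ ^ a * ((‖c‖ * A0) ^ a * (‖c‖ * A1) ^ b) := by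
      rw [Real.mul_rpow hc0 hA0n, Real.mul_rpow hc0 hA1n]
      conv_lhs => rw [hc1]
      ring
    rw [e, hcA0, hcA1]
    have h1' : 1 ≤ ‖c‖ ^ a := Real.one_le_rpow hcge ha0
    have h2' : 1 ≤ ‖PC.eval 0‖ ^ a := Real.one_le_rpow hge0 ha0
    have h3' : 1 ≤ ‖PC.eval 1‖ ^ b := Real.one_le_rpow hge1 hb0
    calc (1 : ℝ) = 1 * (1 * 1) := by ring
      _ ≤ ‖c‖ ^ a * (‖PC.eval 0‖ ^ a * ‖PC.eval 1‖ ^ b) :=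
          mul_le_mul h1' (mul_le_mul h2' h3' zero_le_one (zero_le_one.trans h2')) (by positivity)
            (zero_le_one.trans h1')
  -- assemble
  rw [hM]
  calc goldenRatio ^ P.natDegree = goldenRatio ^ P.natDegree * 1 := (mul_one _).symm
    _ ≤ goldenRatio ^ P.natDegree * (‖c‖ * (A0 ^ a * A1 ^ b)) :=
        mul_le_mul_of_nonneg_left hlow (by positivity)
    _ = ‖c‖ * (goldenRatio ^ P.natDegree * (A0 ^ a * A1 ^ b)) := by ring
    _ ≤ ‖c‖ * (R.map fun α => max 1 ‖α‖).prod := mul_le_mul_of_nonneg_left hprodle hc0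

end Summit.Ventures.DiscreteObjects.Mahler
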